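import Summits.CriticalPhenomena.PercolationContinuityZ3.Theorems.PercNearOneGluingNoHeavyLowerTailKnQuestion8CoefficientwiseCoreClassKernelMixHubPathJGate
import Summits.CriticalPhenomena.PercolationContinuityZ3.Theorems.PercNearOneGluingNoHeavyLowerTailKnQuestion8CoefficientwiseCoreClassKernelMixHubPathJUWalls
import HarnessLib

/-!
# The path lemma for the gate type `(j,u)`, all positions (PATH LEMMA of hub-Kleitman, memo §1.5)

Support file (`--supports stmt-CriticalPhenomena-4575`, closed), prover `prim-cplus-coupling` (gen 51).  No definitions, no notations,
no named facts, no sorries; standard axioms.  Memo `prim-cplus-coupling/A5-COUPLING-gen51.md` §1.5; memo-50 §2.8.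

`hubPath_ju`: word form as in `…KernelMixHubPathGeneric`; `W = {C_u ∪ C_b ∉ 𝒳, C_u(complement) ∈ 𝒴}`.  With `t = min{i : [0,i] ∈ 𝒴}`:
`t = 0` is the `(j,j)` instance `(𝒳, ⊤)` (`hubPath_jj`); for `t ≥ 1` the sources are the blue-starting words with walls in
`𝔼 = {min D ≥ t, |D| odd ⇒ max D ≥ q}` (`q = min{y : {w₀} ∪ [y,ℓ] ∉ 𝒳}`), the targets the red-starting ones, and the source with walls `D`
is sent to the target with walls `g(D)` (`…KernelMixHubPathJUWalls`): a prefix fill `[1,t]`, plus the suffix fill `[q,ℓ]` in the case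
`g(D) = D △ {t, q-1}`, or the full fill for `g(∅) = ∅`.  Injectivity: `hubPath_ju_inj` and `walls_ext`.  Hence `#(F ∩ W) ≤ #(F ∩ cW)`.
[cite: KozmaNitzan2024, Questions 8–9 (§5.5 p. 36) (context)]
-/

namespace Summit.CriticalPhenomena.PercolationContinuityZ3.Theorems

open Finset
open scoped symmDiff

namespace Coefficientwise

open Classical in
/-- **PATH LEMMA, gate type `(j,u)`** (memo §1.5; memo-50 §2.8), all positions of `𝒳, 𝒴`, `ℓ ≥ 2`. [folklore] -/
theorem hubPath_ju (ℓ : ℕ) (hℓ : 2 ≤ ℓ)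
    (X Y : Finset ℕ → Prop) (hXmono : ∀ S T : Finset ℕ, S ⊆ T → X S → X T)
    (hYmono : ∀ S T : Finset ℕ, S ⊆ T → Y S → Y T)
    (D : Finset ℕ → Finset ℕ) (hD : ∀ ω, D ω = (Icc 1 (ℓ - 1)).filter (fun k => ¬ (k ∈ ω ↔ k + 1 ∈ ω)))
    (ri ra rj rb : Finset ℕ → ℕ)
    (hri : ∀ ω, ri ω = if 1 ∈ ω then (if h : (D ω).Nonempty then (D ω).min' h else ℓ) else 0)
    (hra : ∀ ω, ra ω = if 1 ∈ ω then 0 else (if h : (D ω).Nonempty then (D ω).min' h else ℓ))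
    (hrj : ∀ ω, rj ω = if ℓ ∈ ω then (if h : (D ω).Nonempty then ℓ - (D ω).max' h else ℓ) else 0)
    (hrb : ∀ ω, rb ω = if ℓ ∈ ω then 0 else (if h : (D ω).Nonempty then ℓ - (D ω).max' h else ℓ))
    (W cW : Finset ℕ → Prop)
    (hW : ∀ ω, W ω ↔ ¬ X (Icc 0 (ri ω) ∪ Icc (ℓ - rj ω) ℓ) ∧ Y (Icc 0 (ra ω)))
    (hcW : ∀ ω, cW ω ↔ ¬ X (Icc 0 (ra ω) ∪ Icc (ℓ - rb ω) ℓ) ∧ Y (Icc 0 (ri ω)))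
    (F : Finset (Finset ℕ)) (hFsub : ∀ ω ∈ F, ω ⊆ Icc 1 ℓ)
    (hFup : ∀ ω ∈ F, ∀ a b : ℕ, a ≤ b → b ≤ ℓ → (∀ k ∈ ω, a < k) → (∀ k ∈ ω, k ≤ b) →
      ω ∪ Icc 1 a ∪ Icc (b + 1) ℓ ∈ F) :
    (F.filter (fun ω => W ω)).card ≤ (F.filter (fun ω => cW ω)).card := by
  classical
  have hℓ1 : 1 ≤ ℓ := by omega
  have hDle := hubPath_walls_le ℓ D hD
  have hDge := hubPath_walls_ge ℓ D hD
  have hlow : ∀ x y, Icc 0 0 ∪ Icc ℓ ℓ ⊆ Icc 0 x ∪ Icc (ℓ - y) ℓ := fun x y =>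
    Finset.union_subset_union (Finset.Icc_subset_Icc_right (Nat.zero_le _)) (Finset.Icc_subset_Icc_left (by omega))
  by_cases hX0 : X (Icc 0 0 ∪ Icc ℓ ℓ)
  · have h0 : F.filter (fun ω => W ω) = ∅ := Finset.filter_eq_empty_iff.mpr fun ω _ hWω =>
      ((hW ω).mp hWω).1 (hXmono _ _ (hlow _ _) hX0)
    rw [h0, Finset.card_empty]; exact Nat.zero_le _
  by_cases hYex : ∃ i, Y (Icc 0 i)
  swap
  · push Not at hYex
    have h0 : F.filter (fun ω => W ω) = ∅ := Finset.filter_eq_empty_iff.mpr fun ω _ hWω =>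
      hYex _ ((hW ω).mp hWω).2
    rw [h0, Finset.card_empty]; exact Nat.zero_le _
  obtain ⟨t, ht, htmin⟩ : ∃ t, Y (Icc 0 t) ∧ ∀ i, i < t → ¬ Y (Icc 0 i) :=
    ⟨Nat.find hYex, Nat.find_spec hYex, fun i hi => Nat.find_min hYex hi⟩
  have hYiff : ∀ i, Y (Icc 0 i) ↔ t ≤ i := by
    intro i; constructor
    · intro h; by_contra hc; exact htmin i (by omega) h
    · intro h; exact hYmono _ _ (Finset.Icc_subset_Icc_right h) ht
  by_cases ht0 : t = 0
  · -- 𝒴 ∋ {w₀}: the (j,j) instance (𝒳, ⊤)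
    have hYall : ∀ i, Y (Icc 0 i) := fun i => (hYiff i).mpr (by omega)
    have hW' : ∀ ω, W ω ↔ ¬ X (Icc 0 (ri ω) ∪ Icc (ℓ - rj ω) ℓ) ∧
        (fun _ : Finset ℕ => True) (Icc 0 (ra ω) ∪ Icc (ℓ - rb ω) ℓ) :=
      fun ω => by rw [hW]; exact ⟨fun h => ⟨h.1, trivial⟩, fun h => ⟨h.1, hYall _⟩⟩
    have hcW' : ∀ ω, cW ω ↔ ¬ X (Icc 0 (ra ω) ∪ Icc (ℓ - rb ω) ℓ) ∧
        (fun _ : Finset ℕ => True) (Icc 0 (ri ω) ∪ Icc (ℓ - rj ω) ℓ) :=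
      fun ω => by rw [hcW]; exact ⟨fun h => ⟨h.1, trivial⟩, fun h => ⟨h.1, hYall _⟩⟩
    exact hubPath_jj ℓ hℓ X (fun _ => True) hXmono (fun _ _ _ _ => trivial) D hD ri ra rj rb hri hra hrj hrb
      W cW hW' hcW' F hFsub hFup
  -- t ≥ 1 : the involution g of memo §1.5
  have ht1 : 1 ≤ t := by omega
  have hY0 : ¬ Y (Icc 0 0) := htmin 0 (by omega)
  have hqex : ∃ y, ¬ X (Icc 0 0 ∪ Icc y ℓ) := ⟨ℓ, hX0⟩
  obtain ⟨q, hq, hqmin⟩ : ∃ q, ¬ X (Icc 0 0 ∪ Icc q ℓ) ∧ ∀ y, y < q → X (Icc 0 0 ∪ Icc y ℓ) :=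
    ⟨Nat.find hqex, Nat.find_spec hqex, fun y hy => not_not.mp (Nat.find_min hqex hy)⟩
  have hqℓ : q ≤ ℓ := by by_contra h; exact hX0 (hqmin ℓ (by omega))
  have hXiff : ∀ y, ¬ X (Icc 0 0 ∪ Icc y ℓ) ↔ q ≤ y := by
    intro y; constructor
    · intro h; by_contra hc; exact h (hqmin y (by omega))
    · intro h h'
      exact hq (hXmono _ _ (Finset.union_subset_union (Finset.Subset.refl _) (Finset.Icc_subset_Icc_left h)) h')
  obtain ⟨g, hg⟩ : ∃ g : Finset ℕ → Finset ℕ, ∀ D', g D' =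
      if (Even D'.card ∧ (∀ d ∈ D', d < q) ∧ t + 2 ≤ q) then D' ∆ {t} ∆ {q - 1}
      else if (D' = ∅ ∧ (t + 1 = q ∨ t = ℓ)) then ∅ else D' ∆ {t} := ⟨_, fun _ => rfl⟩
  -- fill amounts and the map
  obtain ⟨fa, hfa⟩ : ∃ f : Finset ℕ → ℕ, ∀ ω, f ω =
      if (Even (D ω).card ∧ (∀ d ∈ D ω, d < q) ∧ t + 2 ≤ q) then t
      else if (D ω = ∅ ∧ (t + 1 = q ∨ t = ℓ)) then ℓ else t := ⟨_, fun _ => rfl⟩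
  obtain ⟨fb, hfb⟩ : ∃ f : Finset ℕ → ℕ, ∀ ω, f ω =
      if (Even (D ω).card ∧ (∀ d ∈ D ω, d < q) ∧ t + 2 ≤ q) then q - 1 else ℓ := ⟨_, fun _ => rfl⟩
  obtain ⟨Φ, hΦ⟩ : ∃ Φ : Finset ℕ → Finset ℕ, ∀ ω, Φ ω = ω ∪ Icc 1 (fa ω) ∪ Icc (fb ω + 1) ℓ :=
    ⟨_, fun _ => rfl⟩
  -- sources
  have hsrc : ∀ ω, ω ⊆ Icc 1 ℓ → W ω → 1 ∉ ω ∧ t ≤ ra ω ∧ (∀ k ∈ ω, t < k) ∧ (∀ d ∈ D ω, t ≤ d) ∧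
      (Even (D ω).card ↔ ℓ ∉ ω) ∧ (¬ Even (D ω).card → ∃ d ∈ D ω, q ≤ d) := by
    intro ω hω hWω
    obtain ⟨hXω, hYω⟩ := (hW ω).mp hWω
    have hta : t ≤ ra ω := (hYiff _).mp hYω
    have h1 : 1 ∉ ω := by intro h1; rw [hra, if_pos h1] at hta; omega
    have hpar := hubPath_even_walls_iff ℓ hℓ1 D hD ω
    rw [hra, if_neg h1] at hta
    have hDt : ∀ d ∈ D ω, t ≤ d := by
      intro d hd
      have hDn : (D ω).Nonempty := ⟨d, hd⟩
      rw [dif_pos hDn] at hta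
      exact le_trans hta ((D ω).min'_le d hd)
    have hlead : ∀ k ∈ ω, t < k := by
      intro k hk
      by_cases hDn : (D ω).Nonempty
      · rw [dif_pos hDn] at hta
        have := hubPath_lt_of_mem_of_first_blue ℓ D hD ω hω h1 hDn k hk
        omega
      · rw [Finset.not_nonempty_iff_eq_empty] at hDn
        have := hubPath_eq_empty_of_first_blue ℓ D hD ω hω h1 hDn
        rw [this] at hk; simp at hk
    have hparity : (Even (D ω).card ↔ ℓ ∉ ω) := by rw [hpar]; tauto
    refine ⟨h1, (hYiff _).mp hYω, hlead, hDt, hparity, fun hodd => ?_⟩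
    have hl : ℓ ∈ ω := by by_contra h; exact hodd (hparity.mpr h)
    have hDn : (D ω).Nonempty := by
      rw [Finset.nonempty_iff_ne_empty]; intro h0; rw [h0] at hodd; simp at hodd
    rw [hri, if_neg h1, hrj, if_pos hl, dif_pos hDn] at hXω
    have hM := hDle ω _ ((D ω).max'_mem hDn)
    have e : ℓ - (ℓ - (D ω).max' hDn) = (D ω).max' hDn := by omega
    rw [e] at hXω
    exact ⟨_, (D ω).max'_mem hDn, (hXiff _).mp hXω⟩
  -- the image word: red start, walls g(D), inside [1, ℓ], and a hub move
  have himg : ∀ ω, ω ⊆ Icc 1 ℓ → W ω →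
      1 ∈ Φ ω ∧ Φ ω ⊆ Icc 1 ℓ ∧ D (Φ ω) = g (D ω) ∧ fa ω ≤ fb ω ∧ fb ω ≤ ℓ ∧
      (∀ k ∈ ω, fa ω < k) ∧ (∀ k ∈ ω, k ≤ fb ω) := by
    intro ω hω hWω
    obtain ⟨h1, hta, hlead, hDt, hparity, hodd⟩ := hsrc ω hω hWω
    have hra_le : ra ω ≤ ℓ := by
      rw [hra, if_neg h1]; split_ifs with h
      · have := hDle ω _ ((D ω).min'_mem h); omega
      · exact le_refl _
    have htℓ : t ≤ ℓ := le_trans hta hra_le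
    have hωle : ∀ k ∈ ω, k ≤ ℓ := fun k hk => (Finset.mem_Icc.mp (hω hk)).2
    have hsub : ∀ a b, a ≤ ℓ → ω ∪ Icc 1 a ∪ Icc (b + 1) ℓ ⊆ Icc 1 ℓ := fun a b ha =>
      Finset.union_subset (Finset.union_subset hω (Finset.Icc_subset_Icc_right ha))
        (Finset.Icc_subset_Icc_left (by omega))
    have hone : ∀ a b, 1 ≤ a → 1 ∈ ω ∪ Icc 1 a ∪ Icc (b + 1) ℓ := fun a b ha =>
      Finset.mem_union_left _ (Finset.mem_union_right _ (Finset.mem_Icc.mpr ⟨le_refl _, ha⟩))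
    rw [hΦ, hfa, hfb, hg]
    by_cases hβ : Even (D ω).card ∧ (∀ d ∈ D ω, d < q) ∧ t + 2 ≤ q
    · -- two-sided fill [1,t] ∪ [q,ℓ]
      simp only [if_pos hβ]
      have hl : ℓ ∉ ω := hparity.mp hβ.1
      have htrail : ∀ k ∈ ω, k ≤ q - 1 := by
        intro k hk
        by_cases hDn : (D ω).Nonempty
        · have h₁ := hubPath_le_of_mem_of_last_blue ℓ D hD ω hω hl hDn k hk
          have h₂ := hβ.2.1 _ ((D ω).max'_mem hDn)
          omega
        · rw [Finset.not_nonempty_iff_eq_empty] at hDn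
          have := hubPath_eq_empty_of_first_blue ℓ D hD ω hω h1 hDn
          rw [this] at hk; simp at hk
      have e : q - 1 + 1 = q := by omega
      refine ⟨hone _ _ ht1, hsub _ _ htℓ, ?_, by omega, by omega, hlead, htrail⟩
      exact hubPath_walls_two_sided_fill ℓ D hD ω t (q - 1) ht1 (by omega) (by omega) hlead htrail
    · simp only [if_neg hβ]
      by_cases hγ : D ω = ∅ ∧ (t + 1 = q ∨ t = ℓ)
      · -- all blue ↦ all red
        simp only [if_pos hγ]
        have hω0 : ω = ∅ := hubPath_eq_empty_of_first_blue ℓ D hD ω hω h1 hγ.1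
        refine ⟨hone _ _ hℓ1, hsub _ _ (le_refl _), ?_, le_refl _, le_refl _, fun k hk => ?_, hωle⟩
        · rw [hω0, Finset.empty_union, Finset.Icc_eq_empty_of_lt (Nat.lt_succ_self ℓ), Finset.union_empty]
          exact (hubPath_walls_const ℓ D hD).2
        · rw [hω0] at hk; simp at hk
      · -- prefix fill [1,t]
        simp only [if_neg hγ]
        have htn : t ≤ ℓ - 1 := by
          by_cases hDn : (D ω).Nonempty
          · exact le_trans (hDt _ ((D ω).min'_mem hDn)) (hDle ω _ ((D ω).min'_mem hDn))
          · rw [Finset.not_nonempty_iff_eq_empty] at hDn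
            have : ¬ (t + 1 = q ∨ t = ℓ) := fun h => hγ ⟨hDn, h⟩
            omega
        refine ⟨hone _ _ ht1, hsub _ _ htℓ, ?_, htℓ, le_refl _, hlead, hωle⟩
        rw [Finset.Icc_eq_empty_of_lt (Nat.lt_succ_self ℓ), Finset.union_empty]
        exact walls_prefix_fill ℓ D hD ω t ht1 htn hlead
  -- the image word is a target and not a source
  have htgt : ∀ ω, ω ⊆ Icc 1 ℓ → W ω → cW (Φ ω) ∧ ¬ W (Φ ω) := by
    intro ω hω hWω
    obtain ⟨h1', hsub', hwalls, _, _, _, _⟩ := himg ω hω hWω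
    obtain ⟨h1, hta, _, hDt, _, hodd⟩ := hsrc ω hω hWω
    have htℓ : t ≤ ℓ := by
      rw [hra, if_neg h1] at hta; split_ifs at hta with h
      · have := hDle ω _ ((D ω).min'_mem h); omega
      · exact hta
    obtain ⟨hgt, hgq⟩ := hubPath_ju_image ℓ t q ht1 g hg (D ω) hDt hodd
    rw [← hwalls] at hgt hgq
    have hra' : ra (Φ ω) = 0 := by rw [hra, if_pos h1']
    constructor
    · rw [hcW, hra']
      constructor
      · -- the 𝒳-condition of the target
        rw [hrb]
        split_ifs with hl hDn
        · exact hX0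
        · have hoddΦ : ¬ Even (D (Φ ω)).card := by
            rw [hubPath_even_walls_iff ℓ hℓ1 D hD]; tauto
          obtain ⟨e, he, heq⟩ := hgq hoddΦ
          have hM := hDle _ _ ((D (Φ ω)).max'_mem hDn)
          have e1 : ℓ - (ℓ - (D (Φ ω)).max' hDn) = (D (Φ ω)).max' hDn := by omega
          rw [e1]
          exact (hXiff _).mpr (le_trans heq ((D (Φ ω)).le_max' e he))
        · exfalso
          have hevΦ : ¬ Even (D (Φ ω)).card := by
            rw [hubPath_even_walls_iff ℓ hℓ1 D hD]; tauto
          rw [Finset.not_nonempty_iff_eq_empty] at hDn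
          rw [hDn] at hevΦ; simp at hevΦ
      · -- the 𝒴-condition: leading red run ≥ t
        rw [hri, if_pos h1']
        split_ifs with hDn
        · exact (hYiff _).mpr (hgt _ ((D (Φ ω)).min'_mem hDn))
        · exact (hYiff _).mpr htℓ
    · rw [hW, hra']
      exact fun h => hY0 h.2
  -- counting
  have hWf : F.filter (fun ω => W ω) = F.filter (fun ω => ω ⊆ Icc 1 ℓ ∧ W ω) := by
    ext ω; simp only [Finset.mem_filter]
    exact ⟨fun ⟨hF, hw⟩ => ⟨hF, hFsub ω hF, hw⟩, fun ⟨hF, _, hw⟩ => ⟨hF, hw⟩⟩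
  have hcWf : F.filter (fun ω => cW ω) = F.filter (fun ω => ω ⊆ Icc 1 ℓ ∧ cW ω) := by
    ext ω; simp only [Finset.mem_filter]
    exact ⟨fun ⟨hF, hw⟩ => ⟨hF, hFsub ω hF, hw⟩, fun ⟨hF, _, hw⟩ => ⟨hF, hw⟩⟩
  rw [hWf, hcWf]
  refine hub_card_filter_le_of_moveInjection F (fun ω => ω ⊆ Icc 1 ℓ ∧ W ω) (fun ω => ω ⊆ Icc 1 ℓ ∧ cW ω)
    (fun ω ω' => ∃ a b : ℕ, a ≤ b ∧ b ≤ ℓ ∧ ω' = ω ∪ Icc 1 a ∪ Icc (b + 1) ℓ ∧ (∀ k ∈ ω, a < k) ∧ (∀ k ∈ ω, k ≤ b))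
    ?_ Φ ?_ ?_
  · rintro ω hω ω' ⟨a, b, hab, hb, rfl, hlead, htrail⟩
    exact hFup ω hω a b hab hb hlead htrail
  · rintro ω ⟨hω, hWω⟩ _
    obtain ⟨_, hsub', _, hab, hb, hlead, htrail⟩ := himg ω hω hWω
    obtain ⟨hc, hnw⟩ := htgt ω hω hWω
    exact ⟨⟨hsub', hc⟩, fun h => hnw h.2, fa ω, fb ω, hab, hb, hΦ ω, hlead, htrail⟩
  · rintro ω ω' ⟨hω, hWω⟩ _ ⟨hω', hWω'⟩ _ h
    obtain ⟨_, _, hwalls, _⟩ := himg ω hω hWω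
    obtain ⟨_, _, hwalls', _⟩ := himg ω' hω' hWω'
    obtain ⟨h1, _, _, hDt, _, hodd⟩ := hsrc ω hω hWω
    obtain ⟨h1', _, _, hDt', _, hodd'⟩ := hsrc ω' hω' hWω'
    have hgg : g (D ω) = g (D ω') := by rw [← hwalls, ← hwalls', h]
    have hDD := hubPath_ju_inj ℓ t q ht1 hqℓ g hg (D ω) (D ω') hDt hodd (hDle ω) hDt' hodd' (hDle ω') hgg
    exact walls_ext ℓ D hD ω ω' hω hω' (iff_of_false h1 h1') hDD

end Coefficientwise

end Summit.CriticalPhenomena.PercolationContinuityZ3.Theorems
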